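import Mathlib
import Summits.Ventures.HodgeRepro2.Tier7.Line1.SepWeight

/-!
# Tier7/Line1/SepWeightSimple — `Wmod s` is simple

Continuation of `SepWeight` (t7-L1-p2, LINE L1 residual probe — the SEPARATING DATUM): cylinder projections
(products of the `(1 ± Z_n)/2`), the elementary level functions `chi s N A`, the decomposition of every level
function into `chi`s, and THE KEY LEMMA `level_le_of_stable` (a stable subspace containing one non-zero level-`N`
function contains the whole level), whence `Wmod_eq_of_stable`: every non-zero stable subspace of `Wmod s` is
`Wmod s` — the restricted tensor product is an algebraically simple module over the Pauli operators.
Author: t7-L1-p2 (prover-pub-hodge-repro2-t7-L1-p2-g0-0). §8(d): NO.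
-/

namespace Summit.Ventures.HodgeRepro2.Tier7.Line1.Sep

open Finset

noncomputable section

/-! ## Cylinder projections and the elementary level functions `chi` -/

/-- the cylinder projection: keep `f` on the configurations agreeing with `A` on `M` -/
def cyl (M A : Finset ℕ) (f : Ω → ℂ) : Ω → ℂ := fun ω => if ω ∩ M = A ∩ M then f ω else 0

/-- agreeing on `insert m M` = agreeing on `M` and at `m` -/
theorem inter_insert_eq_iff {ω A M : Finset ℕ} {m : ℕ} :
    ω ∩ insert m M = A ∩ insert m M ↔ ω ∩ M = A ∩ M ∧ (m ∈ ω ↔ m ∈ A) := by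
  constructor
  · intro h
    refine ⟨?_, ?_⟩
    · ext x
      constructor
      · intro hx
        have hx' := Finset.mem_inter.1 hx
        have : x ∈ A ∩ insert m M := h ▸ Finset.mem_inter.2 ⟨hx'.1, mem_insert_of_mem hx'.2⟩
        exact Finset.mem_inter.2 ⟨(Finset.mem_inter.1 this).1, hx'.2⟩
      · intro hx
        have hx' := Finset.mem_inter.1 hx
        have : x ∈ ω ∩ insert m M := h ▸ Finset.mem_inter.2 ⟨hx'.1, mem_insert_of_mem hx'.2⟩
        exact Finset.mem_inter.2 ⟨(Finset.mem_inter.1 this).1, hx'.2⟩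
    · constructor
      · intro hm
        have : m ∈ A ∩ insert m M := h ▸ Finset.mem_inter.2 ⟨hm, mem_insert_self m M⟩
        exact (Finset.mem_inter.1 this).1
      · intro hm
        have : m ∈ ω ∩ insert m M := h.symm ▸ Finset.mem_inter.2 ⟨hm, mem_insert_self m M⟩
        exact (Finset.mem_inter.1 this).1
  · rintro ⟨h1, h2⟩
    ext x
    simp only [mem_inter, mem_insert]
    rcases eq_or_ne x m with rfl | hx
    · simp [h2]
    · have := congrArg (x ∈ ·) h1
      simp only [mem_inter, eq_iff_iff] at this
      simp [hx, this]

/-- the empty cylinder condition is void -/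
theorem cyl_empty (A : Finset ℕ) (f : Ω → ℂ) : cyl ∅ A f = f := by
  funext ω; simp [cyl]

/-- one more qubit in the cylinder = one more projection -/
theorem cyl_insert (M A : Finset ℕ) (m : ℕ) (f : Ω → ℂ) :
    cyl (insert m M) A f = if m ∈ A then projc m (cyl M A f) else proj m (cyl M A f) := by
  funext ω
  by_cases hA : m ∈ A
  · simp only [cyl, projc, hA, if_true, inter_insert_eq_iff]
    by_cases hω : m ∈ ω
    · simp [hω]
    · simp [hω]
  · simp only [cyl, proj, hA, if_false, inter_insert_eq_iff]
    by_cases hω : m ∈ ω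
    · simp [hω]
    · simp [hω]

/-- a stable subspace is stable under all cylinder projections -/
theorem Stable.cyl_mem {Q : Submodule ℂ (Ω → ℂ)} (hQ : Stable Q) (M A : Finset ℕ) {f : Ω → ℂ}
    (hf : f ∈ Q) : cyl M A f ∈ Q := by
  induction M using Finset.induction_on with
  | empty => rw [cyl_empty]; exact hf
  | insert m M _ ih =>
    rw [cyl_insert]
    split_ifs
    · exact hQ.projc_mem m ih
    · exact hQ.proj_mem m ih

/-- the elementary level function: `wt s (ω \ N)` on the cylinder of `A` over `N`, `0` elsewhere -/
def chi (s : ℕ → ℂ) (N A : Finset ℕ) : Ω → ℂ :=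
  fun ω => if ω ∩ N = A ∩ N then wt s (ω \ N) else 0

/-- `chi s N A` is of level `N` -/
theorem chi_mem_level (s : ℕ → ℂ) (N A : Finset ℕ) : chi s N A ∈ level s N :=
  ⟨fun B => if B = A ∩ N then 1 else 0, fun ω => by
    simp only [chi]; split_ifs <;> simp⟩

/-- `chi s N A` is `1` at the base point `A ∩ N` of its cylinder -/
theorem chi_apply_self (s : ℕ → ℂ) (N A : Finset ℕ) : chi s N A (A ∩ N) = 1 := by
  have : (A ∩ N) \ N = ∅ := Finset.sdiff_eq_empty_iff_subset.2 Finset.inter_subset_right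
  simp [chi, this]

/-- `chi s N A` is not the zero function -/
theorem chi_ne_zero (s : ℕ → ℂ) (N A : Finset ℕ) : chi s N A ≠ 0 := by
  intro h
  have := congrFun h (A ∩ N)
  rw [chi_apply_self] at this
  simp at this

/-- the cylinder projection of a level-`N` function is a multiple of `chi` -/
theorem cyl_eq_chi {s : ℕ → ℂ} {N : Finset ℕ} {f : Ω → ℂ} {F : Finset ℕ → ℂ}
    (hF : ∀ ω, f ω = F (ω ∩ N) * wt s (ω \ N)) (A : Finset ℕ) :
    cyl N A f = F (A ∩ N) • chi s N A := by
  funext ω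
  simp only [cyl, chi, Pi.smul_apply, smul_eq_mul]
  split_ifs with h
  · rw [hF ω, h]
  · simp

/-- moving a single flip across an equality -/
theorem symmDiff_singleton_eq_iff {X Y : Finset ℕ} {m : ℕ} :
    symmDiff X {m} = Y ↔ X = symmDiff Y {m} := by
  constructor
  · intro h; rw [← h, symmDiff_symmDiff_cancel_right]
  · intro h; rw [h, symmDiff_symmDiff_cancel_right]

/-- flipping a qubit of `N` permutes the `chi`s -/
theorem flip_chi (s : ℕ → ℂ) {N : Finset ℕ} {m : ℕ} (hm : m ∈ N) (A : Finset ℕ) :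
    flip m (chi s N A) = chi s N (symmDiff A {m}) := by
  funext ω
  simp only [flip, chi, inter_symmDiff_singleton hm, sdiff_symmDiff_singleton hm,
    symmDiff_singleton_eq_iff]

/-- the `chi`s are eigenvectors of the signs of the qubits of `N` -/
theorem sgn_chi (s : ℕ → ℂ) {N : Finset ℕ} {m : ℕ} (hm : m ∈ N) (A : Finset ℕ) :
    sgn m (chi s N A) = (if m ∈ A then (-1 : ℂ) else 1) • chi s N A := by
  funext ω
  simp only [sgn, chi, Pi.smul_apply, smul_eq_mul]
  by_cases h : ω ∩ N = A ∩ N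
  · have hiff : m ∈ ω ↔ m ∈ A := by
      have := congrArg (m ∈ ·) h
      simp only [mem_inter, hm, and_true, eq_iff_iff] at this
      exact this
    simp only [h, if_true]
    by_cases hω : m ∈ ω
    · simp [hω, hiff.1 hω]
    · have hA : m ∉ A := fun h' => hω (hiff.2 h')
      simp [hω, hA]
  · simp [h]

/-- `chi` depends on `A` only through `A ∩ N` -/
theorem chi_congr (s : ℕ → ℂ) {N A A' : Finset ℕ} (h : A ∩ N = A' ∩ N) : chi s N A = chi s N A' := by
  funext ω; simp only [chi, h]

/-- from one `chi` of level `N` in a stable subspace, all flips of it -/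
theorem Stable.chi_symmDiff_mem {Q : Submodule ℂ (Ω → ℂ)} (hQ : Stable Q) {s : ℕ → ℂ} {N A : Finset ℕ}
    (hA : chi s N A ∈ Q) (D : Finset ℕ) (hD : D ⊆ N) : chi s N (symmDiff A D) ∈ Q := by
  induction D using Finset.induction_on with
  | empty => rw [show symmDiff A (∅ : Finset ℕ) = A from symmDiff_bot A]; exact hA
  | insert m D hmD ih =>
    have hm : m ∈ N := hD (mem_insert_self m D)
    have hD' : D ⊆ N := fun x hx => hD (mem_insert_of_mem hx)
    have hins : insert m D = symmDiff D {m} := by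
      rw [Finset.insert_eq, Disjoint.symmDiff_eq_sup (by simpa using hmD), sup_comm]
      rfl
    rw [hins, ← symmDiff_assoc, ← flip_chi s hm]
    exact hQ.flip_mem m _ (ih hD')

/-- every level function is a finite combination of the `chi`s -/
theorem eq_sum_chi {s : ℕ → ℂ} {N : Finset ℕ} {f : Ω → ℂ} {F : Finset ℕ → ℂ}
    (hF : ∀ ω, f ω = F (ω ∩ N) * wt s (ω \ N)) :
    f = ∑ A ∈ N.powerset, F A • chi s N A := by
  funext ω
  simp only [Finset.sum_apply, Pi.smul_apply, smul_eq_mul, chi]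
  rw [Finset.sum_eq_single (ω ∩ N)]
  · simp [hF ω]
  · intro A hA hne
    have hAN : A ∩ N = A := Finset.inter_eq_left.2 (Finset.mem_powerset.1 hA)
    rw [hAN, if_neg (Ne.symm hne), mul_zero]
  · intro h
    exact absurd (Finset.mem_powerset.2 Finset.inter_subset_right) h

/-- THE KEY LEMMA: a stable subspace containing one non-zero level-`N` function contains the whole level -/
theorem level_le_of_stable {Q : Submodule ℂ (Ω → ℂ)} (hQ : Stable Q) {s : ℕ → ℂ} {N : Finset ℕ}
    {f : Ω → ℂ} (hfQ : f ∈ Q) (hfN : f ∈ level s N) (hf0 : f ≠ 0) : level s N ≤ Q := by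
  obtain ⟨F, hF⟩ := hfN
  -- a configuration where `f` does not vanish
  obtain ⟨ω₀, hω₀⟩ := Function.ne_iff.1 hf0
  have hF0 : F (ω₀ ∩ N) ≠ 0 := by
    intro h; apply hω₀; rw [hF ω₀, h, zero_mul]; rfl
  -- the elementary function of its cylinder lies in `Q`
  have hchi : chi s N ω₀ ∈ Q := by
    have h1 : cyl N ω₀ f ∈ Q := hQ.cyl_mem N ω₀ hfQ
    rw [cyl_eq_chi hF] at h1
    have h2 := Q.smul_mem (F (ω₀ ∩ N))⁻¹ h1
    rwa [smul_smul, inv_mul_cancel₀ hF0, one_smul] at h2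
  -- hence every elementary function of level `N`
  have hall : ∀ A ∈ N.powerset, chi s N A ∈ Q := by
    intro A hA
    have hD : symmDiff (ω₀ ∩ N) (A ∩ N) ⊆ N := by
      intro x hx
      rcases Finset.mem_symmDiff.1 hx with ⟨h, _⟩ | ⟨h, _⟩
      · exact (Finset.mem_inter.1 h).2
      · exact (Finset.mem_inter.1 h).2
    have h1 := hQ.chi_symmDiff_mem hchi _ hD
    have h2 : chi s N (symmDiff ω₀ (symmDiff (ω₀ ∩ N) (A ∩ N))) = chi s N A := by
      apply chi_congr
      ext x
      simp only [mem_inter, Finset.mem_symmDiff]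
      by_cases hxN : x ∈ N <;> by_cases hxA : x ∈ A <;> by_cases hx0 : x ∈ ω₀ <;>
        simp [hxN, hxA, hx0]
    rwa [h2] at h1
  -- conclude by the decomposition
  rintro g ⟨G, hG⟩
  rw [eq_sum_chi hG]
  exact Q.sum_mem fun A hA => Q.smul_mem _ (hall A hA)

/-- `Wmod s` is SIMPLE: a non-zero stable subspace of it is everything -/
theorem Wmod_eq_of_stable {Q : Submodule ℂ (Ω → ℂ)} (hQ : Stable Q) {s : ℕ → ℂ} (hle : Q ≤ Wmod s)
    (hne : Q ≠ ⊥) : Q = Wmod s := by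
  refine le_antisymm hle ?_
  obtain ⟨f, hfQ, hf0⟩ := (Submodule.ne_bot_iff Q).1 hne
  obtain ⟨N₀, hN₀⟩ := mem_Wmod_iff.1 (hle hfQ)
  intro g hg
  obtain ⟨N₁, hN₁⟩ := mem_Wmod_iff.1 hg
  have hf : f ∈ level s (N₀ ∪ N₁) := level_mono subset_union_left hN₀
  have hg' : g ∈ level s (N₀ ∪ N₁) := level_mono subset_union_right hN₁
  exact level_le_of_stable hQ hfQ hf hf0 hg'

end

end Summit.Ventures.HodgeRepro2.Tier7.Line1.Sep
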